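/-
Copyright (c) 2026. All rights reserved.
Released under Apache 2.0 license as described in the file LICENSE.
Authors: abc-iut cell, prover seat abc-iut-f-101 (F fact-proving wave), over the statements of abc-iut-L4-t3.
-/
import Literature.AnabelianGeometry.AbsoluteAnabelian.LogFrobeniusCorollaries

/-!
# [AbsTopIII] Corollary 5.10 (iv)(a): the vertex set `D•⊢_{≤n-1} ∪ D•_{≤n}` (`monoBase`) — FACT-LIST row F-0146 settled as a DEFINITION

S. Mochizuki, *Topics in absolute anabelian geometry III: global reconstruction algorithms*,
J. Math. Sci. Univ. Tokyo 22 (2015) 939–1156 [MochizukiAbsTopIII2015]; locators `p.N` = pages of the author's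
manuscript (`paper:url-5493eb38cbb7`), read on the page: Cor 5.10 (iv)(a) p. 147 ("`D•⊢_{≤n}` admits a natural
structure of core on the subdiagram of categories of `D•⊢` determined by the union `D•⊢_{≤n-1} ∪ D•_{≤n}`").

PROOF-ONLY companion (theorems only; nothing restated) of abc-iut-L4-t3's `LogFrobeniusCorollaries.lean`, whose
`LogFrobeniusSetting.monoBase n x` — "`x` is a vertex of `D•⊢_{≤n-1} ∪ D•_{≤n}` (mono-analytic rows `≤ n-1`,
holomorphic rows `≤ n`)" — is the cell's frozen FACT-LIST row F-0146.  That declaration is a DEFINITION (a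
membership predicate on the vertices of the quiver `DVertex`, parameters `n : ℕ`, `x : DVertex Vmod isArc`), not a
claim of print, so as a "fact" it can only be read two ways, both settled here in the kernel:

* its UNIVERSAL CLOSURE `∀ n x, monoBase n x` is FALSE over every index set (`not_forall_monoBase`: the row-7 vertex
  `ℰ•` is not in `D•⊢_{≤4} ∪ D•_{≤5}`), so no consumer may take the closure as a hypothesis;
* the INSTANCE FORMS that the one consumer in the tree binds — the six membership hypotheses `hcore`, `hnp`, `hnv`,
  `he5`, `hem`, `hnm` of `LogFrobeniusSetting.Cor510MonoTelecore` (Cor 5.10 (iv)(b)(c), `n = 6`: the vertices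
  `□`, `𝒩⊞_v`, `𝒩_v`, `ℰ•`, `ℰ⊢`, `𝒩⊢⊞_v` of the length-6 / length-2 paths of the contact structure `ℋ_{An⊢}`) — are
  TRUE (`monoBase_six_core`, …, `monoBase_six_nmonoPlus`; bundled as `monoBase_six_telecorePaths`), together with the
  complementary non-memberships at `n = 6` (the core vertex `An⊢[𝒩⊢⊞]` and the row-7 vertices lie outside the base,
  `not_monoBase_six_anMono` etc.) and the general membership lemmas by row.

(`monoBase_iff`, `monoBase_of_inFirstRows_four` are abc-iut-L4-t15's, `LogFrobeniusMonoCoresProofs.lean`; not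
restated.)  Refereed pre-IUT material; nothing here bears on [IUTchIII] Cor. 3.12; OUR kernel check, no side taken.
-/

set_option autoImplicit false

universe u

namespace Literature.AnabelianGeometry.AbsoluteAnabelian

namespace LogFrobeniusSetting

variable {Vmod : Type u} {isArc : Vmod → Bool}

/-! ## The universal closure of the row is false -/

/-- **F-0146, universal closure REFUTED**: it is not the case that every vertex of `D•⊢` lies in every
`D•⊢_{≤n-1} ∪ D•_{≤n}` — the holomorphic row-7 vertex `ℰ•` is not in `D•⊢_{≤4} ∪ D•_{≤5}` (nor is any vertex in the
`n = 0` base).  [cite: MochizukiAbsTopIII2015, Cor 5.10 (iv)(a) p.147] -/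
theorem not_forall_monoBase : ¬ ∀ (n : ℕ) (x : DVertex Vmod isArc), monoBase n x := by
  intro h
  rcases h 5 .e7 with ⟨-, h7⟩ | ⟨hh, -⟩
  · exact absurd h7 (by simp [DVertex.row])
  · exact hh trivial

/-- Already the `n = 0` base `D•⊢_{≤-1} ∪ D•_{≤0}` (with `0 - 1 = 0` in `ℕ`) contains no vertex at all.
[cite: MochizukiAbsTopIII2015, Cor 5.10 (iv)(a) p.147] -/
theorem not_monoBase_zero (x : DVertex Vmod isArc) : ¬ monoBase 0 x := by
  rintro (⟨-, h⟩ | ⟨-, h⟩) <;> cases x <;> simp [DVertex.row] at h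

/-! ## Membership by row -/

/-- a holomorphic vertex of row `≤ n` lies in `D•⊢_{≤n-1} ∪ D•_{≤n}`. [cite: MochizukiAbsTopIII2015, Cor 5.10 (iv)(a) p.147] -/
theorem monoBase_of_isHolomorphic {n : ℕ} {x : DVertex Vmod isArc} (hx : x.IsHolomorphic) (hr : x.row ≤ n) :
    monoBase n x := Or.inl ⟨hx, hr⟩

/-- a mono-analytic vertex of row `≤ n - 1` lies in `D•⊢_{≤n-1} ∪ D•_{≤n}`. [cite: MochizukiAbsTopIII2015, Cor 5.10 (iv)(a) p.147] -/
theorem monoBase_of_not_isHolomorphic {n : ℕ} {x : DVertex Vmod isArc} (hx : ¬ x.IsHolomorphic)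
    (hr : x.row ≤ n - 1) : monoBase n x := Or.inr ⟨hx, hr⟩

/-- the row bound of a holomorphic member. [cite: MochizukiAbsTopIII2015, Cor 5.10 (iv)(a) p.147] -/
theorem row_le_of_monoBase {n : ℕ} {x : DVertex Vmod isArc} (h : monoBase n x) (hx : x.IsHolomorphic) :
    x.row ≤ n := by
  rcases h with ⟨-, hr⟩ | ⟨hh, -⟩
  · exact hr
  · exact absurd hx hh

/-- the row bound of a mono-analytic member. [cite: MochizukiAbsTopIII2015, Cor 5.10 (iv)(a) p.147] -/
theorem row_le_pred_of_monoBase {n : ℕ} {x : DVertex Vmod isArc} (h : monoBase n x) (hx : ¬ x.IsHolomorphic) :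
    x.row ≤ n - 1 := by
  rcases h with ⟨hh, -⟩ | ⟨-, hr⟩
  · exact absurd hh hx
  · exact hr

/-- the bases grow with `n`. [cite: MochizukiAbsTopIII2015, Cor 5.10 (iv)(a) p.147] -/
theorem monoBase_mono {m n : ℕ} (hmn : m ≤ n) {x : DVertex Vmod isArc} (h : monoBase m x) : monoBase n x := by
  rcases h with ⟨hh, hr⟩ | ⟨hh, hr⟩
  · exact Or.inl ⟨hh, hr.trans hmn⟩
  · exact Or.inr ⟨hh, hr.trans (Nat.sub_le_sub_right hmn 1)⟩

/-- `D•_{≤n} ⊆ D•⊢_{≤n-1} ∪ D•_{≤n}` (the holomorphic part of the base is the printed `D•_{≤n}`).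
[cite: MochizukiAbsTopIII2015, Cor 5.10 (iv)(a) p.147] -/
theorem monoBase_of_inFirstRows {n : ℕ} {x : DVertex Vmod isArc} (h : x.InFirstRows n) : monoBase n x :=
  Or.inl h

/-! ## The instance forms at `n = 6` bound by `Cor510MonoTelecore` (Cor 5.10 (iv)(b)(c)) -/

/-- `𝒳_⋎ ∈ D•⊢_{≤5} ∪ D•_{≤6}` for every `⋎ ∈ L`. [cite: MochizukiAbsTopIII2015, Cor 5.10 (iv)(b) p.147] -/
theorem monoBase_six_row1 (k : ℤ) : monoBase (Vmod := Vmod) (isArc := isArc) 6 (.row1 k) :=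
  Or.inl ⟨trivial, by simp [DVertex.row]⟩

/-- `□ ∈ D•⊢_{≤5} ∪ D•_{≤6}` (hypothesis `hcore` of `Cor510MonoTelecore`). [cite: MochizukiAbsTopIII2015, Cor 5.10 (iv)(c) p.148] -/
theorem monoBase_six_core : monoBase (Vmod := Vmod) (isArc := isArc) 6 .core :=
  Or.inl ⟨trivial, by simp [DVertex.row]⟩

/-- `𝒩⊞_v ∈ D•⊢_{≤5} ∪ D•_{≤6}` (hypothesis `hnp`). [cite: MochizukiAbsTopIII2015, Cor 5.10 (iv)(c) p.148] -/
theorem monoBase_six_nplus (v : Vmod) : monoBase (isArc := isArc) 6 (.nplus v) :=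
  Or.inl ⟨trivial, by simp [DVertex.row]⟩

/-- `𝒩_v ∈ D•⊢_{≤5} ∪ D•_{≤6}` (hypothesis `hnv`). [cite: MochizukiAbsTopIII2015, Cor 5.10 (iv)(c) p.148] -/
theorem monoBase_six_nv (v : Vmod) : monoBase (isArc := isArc) 6 (.nv v) :=
  Or.inl ⟨trivial, by simp [DVertex.row]⟩

/-- `ℰ• ∈ D•⊢_{≤5} ∪ D•_{≤6}` (row 5; hypothesis `he5`). [cite: MochizukiAbsTopIII2015, Cor 5.10 (iv)(c) p.148] -/
theorem monoBase_six_e5 : monoBase (Vmod := Vmod) (isArc := isArc) 6 .e5 :=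
  Or.inl ⟨trivial, by simp [DVertex.row]⟩

/-- `An•[𝒳] ∈ D•⊢_{≤5} ∪ D•_{≤6}` (row 6, holomorphic). [cite: MochizukiAbsTopIII2015, Cor 5.10 (iv)(b) p.147] -/
theorem monoBase_six_an : monoBase (Vmod := Vmod) (isArc := isArc) 6 .an :=
  Or.inl ⟨trivial, by simp [DVertex.row]⟩

/-- `𝒩⊢⊞_w ∈ D•⊢_{≤5} ∪ D•_{≤6}` (mono-analytic row 3; hypothesis `hnm`, the targets of the telecore edges
`φ^{An⊢⊞}_{w,ν}`). [cite: MochizukiAbsTopIII2015, Cor 5.10 (iv)(b) p.147] -/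
theorem monoBase_six_nmonoPlus (w : Vmod) : monoBase (isArc := isArc) 6 (.nmonoPlus w) :=
  Or.inr ⟨not_false, by simp [DVertex.row]⟩

/-- `𝒩⊢_w ∈ D•⊢_{≤5} ∪ D•_{≤6}` (mono-analytic row 4). [cite: MochizukiAbsTopIII2015, Cor 5.10 (iv)(b) p.147] -/
theorem monoBase_six_nmono (w : Vmod) : monoBase (isArc := isArc) 6 (.nmono w) :=
  Or.inr ⟨not_false, by simp [DVertex.row]⟩

/-- `ℰ⊢ ∈ D•⊢_{≤5} ∪ D•_{≤6}` (mono-analytic row 5; hypothesis `hem`). [cite: MochizukiAbsTopIII2015, Cor 5.10 (iv)(c) p.148] -/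
theorem monoBase_six_emono5 : monoBase (Vmod := Vmod) (isArc := isArc) 6 .emono5 :=
  Or.inr ⟨not_false, by simp [DVertex.row]⟩

/-- **F-0146 at the instances the consumer binds**: the six membership hypotheses `hcore`, `hnp`, `hnv`, `he5`,
`hem`, `hnm` of `LogFrobeniusSetting.Cor510MonoTelecore` hold for every `v ∈ V(F_mod)` — the vertices of the
length-6 path `□ → 𝒩⊞_v → 𝒩_v → ℰ• → ℰ⊢ → An⊢[𝒩⊢⊞] → 𝒩⊢⊞_v` and of the length-2 path `□ → 𝒩⊞_v → 𝒩⊢⊞_v` of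
Cor 5.10 (iv)(c) other than the core vertex all lie in `D•⊢_{≤5} ∪ D•_{≤6}`.
[cite: MochizukiAbsTopIII2015, Cor 5.10 (iv)(c) p.148] -/
theorem monoBase_six_telecorePaths (v : Vmod) :
    monoBase (isArc := isArc) 6 .core ∧ monoBase (isArc := isArc) 6 (.nplus v) ∧
      monoBase (isArc := isArc) 6 (.nv v) ∧ monoBase (isArc := isArc) 6 .e5 ∧
      monoBase (isArc := isArc) 6 .emono5 ∧ monoBase (isArc := isArc) 6 (.nmonoPlus v) :=
  ⟨monoBase_six_core, monoBase_six_nplus v, monoBase_six_nv v, monoBase_six_e5, monoBase_six_emono5,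
    monoBase_six_nmonoPlus v⟩

/-! ## Non-members at `n = 6`: the core vertex and row 7 -/

/-- the core vertex `An⊢[𝒩⊢⊞]` (mono-analytic row 6) is NOT in the base `D•⊢_{≤5} ∪ D•_{≤6}` — it is the observation
vertex adjoined to it. [cite: MochizukiAbsTopIII2015, Cor 5.10 (iv)(b) p.147] -/
theorem not_monoBase_six_anMono : ¬ monoBase (Vmod := Vmod) (isArc := isArc) 6 .anMono := by
  rintro (⟨h, -⟩ | ⟨-, h⟩)
  · exact h
  · simp [DVertex.row] at h

/-- the row-7 vertex `ℰ•` is not in `D•⊢_{≤5} ∪ D•_{≤6}`. [cite: MochizukiAbsTopIII2015, Cor 5.10 (iv)(a) p.147] -/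
theorem not_monoBase_six_e7 : ¬ monoBase (Vmod := Vmod) (isArc := isArc) 6 .e7 := by
  rintro (⟨-, h⟩ | ⟨h, -⟩)
  · simp [DVertex.row] at h
  · exact h trivial

/-- the row-7 vertex `ℰ⊢` is not in `D•⊢_{≤5} ∪ D•_{≤6}`. [cite: MochizukiAbsTopIII2015, Cor 5.10 (iv)(a) p.147] -/
theorem not_monoBase_six_emono7 : ¬ monoBase (Vmod := Vmod) (isArc := isArc) 6 .emono7 := by
  rintro (⟨h, -⟩ | ⟨-, h⟩)
  · exact h
  · simp [DVertex.row] at h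

/-- **Decision of the `n = 6` base**: a vertex of `D•⊢` lies in `D•⊢_{≤5} ∪ D•_{≤6}` iff it is not one of
`An⊢[𝒩⊢⊞]`, `ℰ•` (row 7), `ℰ⊢` (row 7). [cite: MochizukiAbsTopIII2015, Cor 5.10 (iv)(a) p.147] -/
theorem monoBase_six_iff (x : DVertex Vmod isArc) :
    monoBase 6 x ↔ x ≠ .anMono ∧ x ≠ .e7 ∧ x ≠ .emono7 := by
  cases x <;>
    simp [monoBase, DVertex.IsHolomorphic, DVertex.row]

end LogFrobeniusSetting

end Literature.AnabelianGeometry.AbsoluteAnabelian
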